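import Mathlib
import Summits.NavierStokesRegularity.NavierStokesRegularity.Theses.TerminalTrace
import Summits.NavierStokesRegularity.NavierStokesRegularity.Theorems.HardyPointSinkBlowupHasSingularPoint
import HarnessLib

/-!
# Route TerminalTrace — support item `BlowupHasSingularPoint` PROVED
  (stmt-NavierStokesRegularity-18382; = stmt-NavierStokesRegularity-9116 of route HardyPointSink)

The item is verbatim the landed `HardyPointSink.BlowupHasSingularPoint`
(`hardyPointSink_blowupHasSingularPoint_proof`): a Fefferman-class solution with no smooth extension
past `T` has a backward-singular point `(T, xs)` — `u` essentially unbounded on every parabolic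
cylinder `(T − r², T) × B(xs, r)`. One-line closure by name.

HONEST FRAMING: bookkeeping about a HYPOTHETICAL singular time; nothing here bears on the
regularity question itself. Lands `--workitem stmt-NavierStokesRegularity-18382` (typer seat g19 of
cell pub-ns-dss, idle-row item).
-/

namespace Summit.NavierStokesRegularity.NavierStokesRegularity.Theorems

set_option linter.dupNamespace false

/-- **`BlowupHasSingularPoint` of route TerminalTrace (stmt-NavierStokesRegularity-18382)** = the
landed `hardyPointSink_blowupHasSingularPoint_proof` (KNSS 2009 / CKN 1982 bookkeeping), by name.
[this file] -/
theorem terminalTrace_blowupHasSingularPoint_proof : Theses.TerminalTrace.BlowupHasSingularPoint :=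
  hardyPointSink_blowupHasSingularPoint_proof

end Summit.NavierStokesRegularity.NavierStokesRegularity.Theorems
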